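import Summits.KontsevichZagierPeriods.KontsevichZagierPeriods.Theorems.OffTetraSectorKernel.Negative.SliceInvariant

/-!
# `OffTetraSectorKernel` (stmt-KontsevichZagierPeriods-10557) — negative side: the slice invariant; rule (2) is independent of rules (1), (3)

Part 3 of 3 (`SliceCore` ⊂ `SliceInvariant` ⊂ `SliceWitness`); cdisprove (refuter) files for the crux
`HyperbolicBloch.OffTetraSectorKernel`; commentary in `Cruxes/OffTetraSectorKernel/Disproof.lean` §7 (k).
Sorry-free; axioms ⊆ {propext, Classical.choice, Quot.sound}.

REFUTED STRENGTHENING of the crux (and of `KZKernelConjecture`): "every kernel element lies in the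
subgroup generated by the additivity moves (1a), (1b) and the Newton–Leibniz move (3)" is FALSE
(`not_ker_le_closure_add_nl`); indeed that subgroup is a PROPER subgroup of `KZ.relations`
(`closure_add_nl_lt_relations`): the change-of-variables move (2) is not generated by the other
three. The certificate is the **slice invariant** `sliceFun : FormalRep →+ (ℝ → ℝ)`,
`[σ, f] ↦ (x ↦ ∫_{σ ∩ {y₀ ≤ x}} f)` (`0` in dimension `0`), read in the quotient of `ℝ → ℝ` by the
subgroup `semialgFun` of `ℚ`-semialgebraic functions:

* (1a), (1b) preserve `sliceFun` on the nose (`KZ.restrictedEval` with the measurable windows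
  `{y₀ ≤ x}`, `sliceFun_eq_zero_of_mem_add`);
* (3) over a base of positive dimension preserves it on the nose, because the window is a cylinder
  over the base window and the analytic core of rule (3) — Fubini along the last coordinate + FTC on
  the fibres, here isolated for raw data as `setIntegral_band_eq_of_hasDerivAt` — applies to the
  windowed band (`sliceFun_eq_zero_of_nl_succ`);
* (3) over the base `ℝ⁰` changes `sliceFun` by a `ℚ`-SEMIALGEBRAIC function: the slice function of
  `[[A,B], F′]` is `0`, then `F(x) − F(A)`, then `F(B) − F(A)` — the primitive `F` is semialgebraic by
  the very format of the move, and its values at the semialgebraic endpoints are semialgebraic points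
  (Tarski–Seidenberg, `isSemialgebraic_setOf_eq_apply`) (`sliceFun_mem_of_nl_zero`);
* hence `closure ((1a) ∪ (1b) ∪ (3)) ≤ semialgFun.comap sliceFun`
  (`closure_add_nl_le_comap_semialgFun`);
* the WITNESS is the region under the hyperbola `y₁ (2 − y₀) < 1` over `(0,1)` against its translate
  by the rational vector `(1, 0)` — ONE rule-(2) instance (`KZ.exists_translate`) — whose slice
  function on `(0,1)` is `log (2/(2 − x))` (`sliceFun_hyperbolaRep`, area under the hyperbola by
  `volume_regionBetween_eq_integral` and `integral_inv_of_pos`); were it `ℚ`-semialgebraic, its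
  negative would be a `ℚ`-semialgebraic primitive of `1/(t − 2)` on `[0,1]`, excluded by the barrier
  theorem `Literature.Barriers.KontsevichZagierPeriods.KZ.noSemialgebraicPrimitive_inv_sub_two_holds`.

Together with `KZSubcalculusInvariants` (`coeffSum`: (1) is not generated by (2), (3)) and the
dimension filter `dimTwoEval` of `Negative/LoadBearing.lean` ((3) is not generated by (1), (2),
even modulo the tetra relators), this shows the three groups of rules of the H21 calculus are
pairwise independent. For the crux WITH the tetrahedral value-relators adjoined the slice class is
silent: the slice volumes `x ↦ vol (T(z) ∩ {p₀ ≤ x})` of ideal tetrahedra are dilogarithmic, and a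
numerical relation `Σ nᵢ D(zᵢ) = 0` does not make `Σ nᵢ vol (T(zᵢ) ∩ {p₀ ≤ x})` semialgebraic.

[Kontsevich–Zagier 2001, §1.2, rules (1)–(3); Ayoub 2015, Rem. 1.5 / Fresán 2024, Rem. 3.7 (in the
cube calculus a one-variable change of variables costs a second variable — the Stokes-only side of the
same independence phenomenon)]
-/


noncomputable section

open MeasureTheory Set Filter


open Literature.NumberTheory.Transcendental Literature.NumberTheory.Transcendental.KZ

namespace Summit.KontsevichZagierPeriods.HyperbolicBloch.OffTetraSectorKernelNegative

open Literature.ModelTheory.ExponentialFields (IsSemialgebraic isSemialgebraic_univ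
  isSemialgebraic_empty tarski_seidenberg_real_holds)

/-! ### The witness: the region under a hyperbola against its translate -/

/-- The region under the hyperbola `y₁ = 1/(2 − y₀)` over `(0, 1)` (open conditions). [folklore] -/
def hyperbolaDomain : Set (Fin 2 → ℝ) :=
  {y | 0 < y 0 ∧ y 0 < 1 ∧ 0 < y 1 ∧ y 1 * (2 - y 0) < 1}

/-- The hyperbola region is `ℚ`-semialgebraic (four polynomial inequalities). [folklore] -/
theorem isSemialgebraic_hyperbolaDomain : IsSemialgebraic ℚ hyperbolaDomain := by
  have h0 : IsSemialgebraic ℚ {y : Fin 2 → ℝ | MvPolynomial.aeval y (0 : MvPolynomial (Fin 2) ℚ) <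
      MvPolynomial.aeval y (MvPolynomial.X 0 : MvPolynomial (Fin 2) ℚ)} :=
    Literature.ModelTheory.ExponentialFields.isSemialgebraic_setOf_eval_lt _ _
  have h1 : IsSemialgebraic ℚ {y : Fin 2 → ℝ | MvPolynomial.aeval y (MvPolynomial.X 0 : MvPolynomial (Fin 2) ℚ) <
      MvPolynomial.aeval y (1 : MvPolynomial (Fin 2) ℚ)} :=
    Literature.ModelTheory.ExponentialFields.isSemialgebraic_setOf_eval_lt _ _
  have h2 : IsSemialgebraic ℚ {y : Fin 2 → ℝ | MvPolynomial.aeval y (0 : MvPolynomial (Fin 2) ℚ) <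
      MvPolynomial.aeval y (MvPolynomial.X 1 : MvPolynomial (Fin 2) ℚ)} :=
    Literature.ModelTheory.ExponentialFields.isSemialgebraic_setOf_eval_lt _ _
  have h3 : IsSemialgebraic ℚ {y : Fin 2 → ℝ |
      MvPolynomial.aeval y (MvPolynomial.X 1 * (MvPolynomial.C 2 - MvPolynomial.X 0) : MvPolynomial (Fin 2) ℚ) <
      MvPolynomial.aeval y (1 : MvPolynomial (Fin 2) ℚ)} :=
    Literature.ModelTheory.ExponentialFields.isSemialgebraic_setOf_eval_lt _ _
  convert ((h0.inter h1).inter h2).inter h3 using 1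
  ext y
  simp only [hyperbolaDomain, mem_setOf_eq, mem_inter_iff, map_zero, MvPolynomial.aeval_X, map_one,
    map_mul, map_sub, MvPolynomial.aeval_C, eq_ratCast, Rat.cast_ofNat]
  tauto

/-- The hyperbola region lies in the unit box. [folklore] -/
theorem hyperbolaDomain_subset_box : hyperbolaDomain ⊆ Icc (0 : Fin 2 → ℝ) 1 := by
  intro y hy
  obtain ⟨h0, h1, h2, h3⟩ := hy
  have hy1 : y 1 ≤ 1 := by nlinarith
  rw [mem_Icc]
  constructor
  · intro i
    fin_cases i
    · exact h0.le
    · exact h2.le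
  · intro i
    fin_cases i
    · exact h1.le
    · exact hy1

/-- The hyperbola region has finite area. [folklore] -/
theorem volume_hyperbolaDomain_lt_top : volume hyperbolaDomain < ⊤ :=
  lt_of_le_of_lt (measure_mono hyperbolaDomain_subset_box) measure_Icc_lt_top

/-- `[hyperbola region, 1]` (value `log 2`). [folklore] -/
def hyperbolaRep : IntegralRep 2 where
  domain := hyperbolaDomain
  integrand := fun _ => 1
  isSemialgebraic_domain := isSemialgebraic_hyperbolaDomain
  isSemialgebraicFunOn_integrand := by
    simpa using isSemialgebraicFunOn_natCast isSemialgebraic_hyperbolaDomain 1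
  integrableOn := integrableOn_const (by exact volume_hyperbolaDomain_lt_top.ne)

/-- The domain of the hyperbola representation. [folklore] -/
@[simp] theorem hyperbolaRep_domain : hyperbolaRep.domain = hyperbolaDomain := rfl
/-- The integrand of the hyperbola representation. [folklore] -/
@[simp] theorem hyperbolaRep_integrand : hyperbolaRep.integrand = fun _ => 1 := rfl

/-- The slice at abscissa `x ∈ (0,1)`, transported to `ℝ × ℝ`, is the region under the hyperbola
over `(0, x]`. [folklore] -/
theorem finTwoArrow_preimage_regionBetween {x : ℝ} (hx : x ∈ Ioo (0 : ℝ) 1) :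
    MeasurableEquiv.finTwoArrow ⁻¹'
        regionBetween (fun _ => (0 : ℝ)) (fun s => 1 / (2 - s)) (Ioc 0 x) =
      hyperbolaDomain ∩ {y : Fin 2 → ℝ | y 0 ≤ x} := by
  ext y
  simp only [mem_preimage, regionBetween, mem_setOf_eq, mem_Ioc, mem_Ioo, hyperbolaDomain,
    mem_inter_iff, MeasurableEquiv.finTwoArrow, MeasurableEquiv.piFinTwo_apply]
  constructor
  · rintro ⟨⟨h1, h2⟩, h3, h4⟩
    have h2x : 0 < 2 - y 0 := by linarith [hx.2]
    refine ⟨⟨h1, by linarith [hx.2], h3, ?_⟩, h2⟩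
    rw [lt_div_iff₀ h2x] at h4
    linarith
  · rintro ⟨⟨h1, h2, h3, h4⟩, h5⟩
    have h2x : 0 < 2 - y 0 := by linarith
    refine ⟨⟨h1, h5⟩, h3, ?_⟩
    rw [lt_div_iff₀ h2x]
    linarith

/-- Area of the slice: `∫₀ˣ ds/(2 − s) = log (2/(2 − x))`. [folklore] -/
theorem volume_hyperbolaDomain_inter {x : ℝ} (hx : x ∈ Ioo (0 : ℝ) 1) :
    volume (hyperbolaDomain ∩ {y : Fin 2 → ℝ | y 0 ≤ x}) =
      ENNReal.ofReal (Real.log (2 / (2 - x))) := by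
  rw [← finTwoArrow_preimage_regionBetween hx]
  have hmp := MeasureTheory.volume_preserving_finTwoArrow ℝ
  have hmeas : MeasurableSet (regionBetween (fun _ => (0 : ℝ)) (fun s => 1 / (2 - s)) (Ioc 0 x)) :=
    measurableSet_regionBetween measurable_const
      ((measurable_const.sub measurable_id).const_div 1) measurableSet_Ioc
  rw [hmp.measure_preimage hmeas.nullMeasurableSet, Measure.volume_eq_prod]
  have hcont : ContinuousOn (fun s : ℝ => 1 / (2 - s)) (Icc 0 x) := by
    apply ContinuousOn.div continuousOn_const (continuousOn_const.sub continuousOn_id)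
    intro s hs h
    simp only [Pi.sub_apply, id_eq] at h
    linarith [hs.2, hx.2]
  have hint : IntegrableOn (fun s : ℝ => 1 / (2 - s)) (Ioc 0 x) :=
    (hcont.integrableOn_compact isCompact_Icc).mono_set Ioc_subset_Icc_self
  rw [volume_regionBetween_eq_integral (integrableOn_const (by simp)) hint measurableSet_Ioc
    (fun s hs => by
      have : 0 < 2 - s := by linarith [hs.2, hx.2]
      simp only [one_div, inv_nonneg]
      exact this.le)]
  congr 1
  have hsub : (fun s : ℝ => 1 / (2 - s)) - (fun _ => (0 : ℝ)) = fun s => 1 / (2 - s) := by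
    funext s; simp
  rw [hsub, ← intervalIntegral.integral_of_le hx.1.le,
    intervalIntegral.integral_comp_sub_left (fun u : ℝ => 1 / u) 2]
  simp only [sub_zero, one_div]
  rw [integral_inv_of_pos (by linarith [hx.2]) (by norm_num)]

/-- The slice function of the hyperbola representation on `(0,1)`. [folklore] -/
theorem sliceFun_hyperbolaRep {x : ℝ} (hx : x ∈ Ioo (0 : ℝ) 1) :
    sliceFun (of hyperbolaRep) x = Real.log (2 / (2 - x)) := by
  rw [sliceFun_of, sliceWindow_succ, hyperbolaRep_domain, hyperbolaRep_integrand,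
    setIntegral_const, measureReal_def, volume_hyperbolaDomain_inter hx, smul_eq_mul, mul_one,
    ENNReal.toReal_ofReal]
  apply Real.log_nonneg
  rw [le_div_iff₀ (by linarith [hx.2])]
  linarith [hx.1]

/-- **Rule (2) is not generated by rules (1) and (3).** The translate of the hyperbola region by
the rational vector `(1, 0)` differs from it by ONE change-of-variables move, but not by any
combination of additivity and Newton–Leibniz moves: the slice class of the difference is
`log (2/(2 − x))` on `(0, 1)`, which is not `ℚ`-semialgebraic
(`noSemialgebraicPrimitive_inv_sub_two_holds`: no `ℚ`-semialgebraic function on `[0,1]` has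
derivative `1/(t − 2)` inside). [folklore] -/
theorem exists_mem_changeOfVariablesRel_not_mem_closure_add_nl :
    ∃ c ∈ changeOfVariablesRel,
      c ∉ AddSubgroup.closure (domainAddRel ∪ integrandAddRel ∪ newtonLeibnizRel) := by
  obtain ⟨r₂, hdom, hint, hcov⟩ := exists_translate hyperbolaRep ![1, 0]
  refine ⟨_, hcov, fun hmem => ?_⟩
  have hclass := closure_add_nl_le_comap_semialgFun hmem
  rw [AddSubgroup.mem_comap, mem_semialgFun] at hclass
  -- the slice function of the difference on `(0,1)`
  have hw : (fun i : Fin 2 => ((![(1 : ℚ), 0] i : ℚ) : ℝ)) = ![(1 : ℝ), 0] := by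
    funext i
    fin_cases i <;> simp
  have hslice : ∀ x ∈ Ioo (0 : ℝ) 1,
      sliceFun (of hyperbolaRep - of r₂) x = Real.log (2 / (2 - x)) := by
    intro x hx
    rw [map_sub, Pi.sub_apply, sliceFun_hyperbolaRep hx, sliceFun_of, sliceWindow_succ]
    have hempty : r₂.domain ∩ {y : Fin 2 → ℝ | y 0 ≤ x} = ∅ := by
      rw [hdom, hw]
      ext y
      simp only [mem_inter_iff, mem_preimage, hyperbolaRep_domain, hyperbolaDomain, mem_setOf_eq,
        Pi.sub_apply, Matrix.cons_val_zero, mem_empty_iff_false, iff_false, not_and, not_le]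
      intro h1
      linarith [h1.1, hx.2]
    rw [hempty, Measure.restrict_empty, integral_zero_measure, sub_zero]
  -- the negative of the slice function is a semialgebraic primitive of `1/(t - 2)` on `[0,1]`
  apply Literature.Barriers.KontsevichZagierPeriods.KZ.noSemialgebraicPrimitive_inv_sub_two_holds
  refine ⟨fun t => -sliceFun (of hyperbolaRep - of r₂) (t 0), ?_, ?_⟩
  · have hIcc : IsSemialgebraic ℚ {t : Fin 1 → ℝ | t 0 ∈ Icc (0 : ℝ) 1} := by
      have ha : IsSemialgebraic ℚ {t : Fin 1 → ℝ | MvPolynomial.aeval t (0 : MvPolynomial (Fin 1) ℚ) ≤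
          MvPolynomial.aeval t (MvPolynomial.X 0 : MvPolynomial (Fin 1) ℚ)} :=
        Literature.ModelTheory.ExponentialFields.isSemialgebraic_setOf_eval_le _ _
      have hb : IsSemialgebraic ℚ {t : Fin 1 → ℝ | MvPolynomial.aeval t (MvPolynomial.X 0 : MvPolynomial (Fin 1) ℚ) ≤
          MvPolynomial.aeval t (1 : MvPolynomial (Fin 1) ℚ)} :=
        Literature.ModelTheory.ExponentialFields.isSemialgebraic_setOf_eval_le _ _
      convert ha.inter hb using 1
      ext t
      simp [mem_Icc]
    exact (hclass.neg).mono (subset_univ _) hIcc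
  · intro t ht
    have h2t : (2 : ℝ) - t ≠ 0 := by linarith [ht.2]
    have hlog : HasDerivAt (fun s : ℝ => Real.log (2 - s) - Real.log 2) (1 / (t - 2)) t := by
      have h1 : HasDerivAt (fun s : ℝ => 2 - s) (-1) t := by
        simpa using (hasDerivAt_id t).const_sub 2
      have h2 := ((Real.hasDerivAt_log h2t).comp t h1).sub_const (Real.log 2)
      have heq : (2 - t)⁻¹ * -1 = 1 / (t - 2) := by
        rw [one_div, mul_neg_one, ← inv_neg, neg_sub]
      exact h2.congr_deriv heq
    apply hlog.congr_of_eventuallyEq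
    filter_upwards [Ioo_mem_nhds ht.1 ht.2] with s hs
    have h2s : (0 : ℝ) < 2 - s := by linarith [hs.2]
    change -sliceFun (of hyperbolaRep - of r₂) s = Real.log (2 - s) - Real.log 2
    rw [hslice s hs, Real.log_div (by norm_num) h2s.ne']
    ring

/-- **The calculus without rule (2) is strictly weaker**: the subgroup generated by additivity
and Newton–Leibniz is a proper subgroup of `KZ.relations`. [folklore] -/
theorem closure_add_nl_lt_relations :
    AddSubgroup.closure (domainAddRel ∪ integrandAddRel ∪ newtonLeibnizRel) < relations := by
  refine lt_of_le_of_ne (AddSubgroup.closure_mono ?_) ?_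
  · rintro c ((hc | hc) | hc)
    · exact Or.inl (Or.inl (Or.inl hc))
    · exact Or.inl (Or.inl (Or.inr hc))
    · exact Or.inr hc
  · intro h
    obtain ⟨c, hc, hnot⟩ := exists_mem_changeOfVariablesRel_not_mem_closure_add_nl
    exact hnot (h ▸ changeOfVariablesRel_subset_relations hc)

/-- **Any proof of the kernel conjecture must use rule (2)**: there is a kernel element outside the
subgroup generated by rules (1a), (1b), (3). [folklore] -/
theorem exists_kernel_not_mem_closure_add_nl :
    ∃ c : FormalRep, eval c = 0 ∧
      c ∉ AddSubgroup.closure (domainAddRel ∪ integrandAddRel ∪ newtonLeibnizRel) := by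
  obtain ⟨c, hc, hnot⟩ := exists_mem_changeOfVariablesRel_not_mem_closure_add_nl
  exact ⟨c, relations_le_ker_eval_holds (changeOfVariablesRel_subset_relations hc), hnot⟩

/-- **Refuted strengthening of the crux / of `KZKernelConjecture`**: the kernel of `eval` is NOT
contained in the subgroup generated by rules (1a), (1b), (3) — so every proof of the kernel
conjecture, and every proof of `OffTetraSectorKernel` that does not spend tetrahedral relators on
it, must use a change of variables. [cite: KontsevichZagier2001, §1.2 rule (2)] -/
theorem not_ker_le_closure_add_nl :
    ¬ (eval.ker ≤ AddSubgroup.closure (domainAddRel ∪ integrandAddRel ∪ newtonLeibnizRel)) := by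
  intro h
  obtain ⟨c, hc, hnot⟩ := exists_kernel_not_mem_closure_add_nl
  exact hnot (h (by rwa [AddMonoidHom.mem_ker]))

end Summit.KontsevichZagierPeriods.HyperbolicBloch.OffTetraSectorKernelNegative
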